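import Summits.CriticalPhenomena.PercolationContinuityZ3.Theses.PercShatteringRace
import Summits.CriticalPhenomena.PercolationContinuityZ3.Theorems.PercShatteringRaceRaceLemma
import HarnessLib

/-!
# Route PercShatteringRace — `Assembly` (stmt-CriticalPhenomena-5789)

`Assembly : FreeSusceptibilityPowerSaving → NearLinearTwoClusterDecay → PercolationContinuityZ3`
(S(1/2) → U(1/6) → θ(p_c) = 0 on ℤ³) is the instance `(a, b) = (1/2, 1/6)` of the route's race
lemma `RaceLemma`, proved in the tree as
`Summit.CriticalPhenomena.PercolationContinuityZ3.Theorems.raceLemma_proof`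
(`Theorems/PercShatteringRaceRaceLemma.lean`): `0 < 1/6` and `(1 + 1/6) (3 - 1/2) = 35/12 < 3`
by `norm_num`, after which the exponents are rewritten `(3 : ℝ) - 1/2 = 5/2` and
`(1 : ℝ) + 1/6 = 7/6` so that the two hypotheses of the instance are literally the two crux decls
`FreeSusceptibilityPowerSaving` and `NearLinearTwoClusterDecay`.
-/

namespace Summit.CriticalPhenomena.PercolationContinuityZ3.Theorems

/-- **Assembly of route PercShatteringRace** (item `stmt-CriticalPhenomena-5789`, exact route decl):
the free-box susceptibility power saving `S(1/2) = FreeSusceptibilityPowerSaving` and the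
near-linear two-cluster decay `U(1/6) = NearLinearTwoClusterDecay` imply `θ(p_c) = 0` for bond
percolation on `ℤ³` (`PercolationContinuityZ3`). It is the instance `(a, b) = (1/2, 1/6)` of the
proved race lemma `raceLemma_proof`: `0 < 1/6`, `(1 + 1/6) (3 - 1/2) = 35/12 < 3`. -/
theorem percShatteringRace_assembly_proof :
    Summit.CriticalPhenomena.PercolationContinuityZ3.Theses.PercShatteringRace.Assembly := by
  unfold Summit.CriticalPhenomena.PercolationContinuityZ3.Theses.PercShatteringRace.Assembly
  intro hS hU
  have h := raceLemma_proof (1 / 2) (1 / 6) (by norm_num) (by norm_num)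
  have e1 : (3 : ℝ) - 1 / 2 = 5 / 2 := by norm_num
  have e2 : (1 : ℝ) + 1 / 6 = 7 / 6 := by norm_num
  rw [e1, e2] at h
  exact h hS hU

end Summit.CriticalPhenomena.PercolationContinuityZ3.Theorems
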